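import Mathlib
import HarnessLib

/-!
# Route `JosephsonMirror` — squarefree integer pencils at transcendental couplings

Helper file for crux stmt-HubbardSuperconductivity-2228 (`JmCusp`, line `Sketch`, stub
`stub_transcendental_squarefree`) of route `JosephsonMirror` (sub-problem
`HubbardSuperconductivity`). Clause (ii) of the crux is the exact non-degeneracy of a ground
level of the Hubbard torus `H(U) = T + U·D`, a Hermitian pencil LINEAR in the coupling `U` with
INTEGER matrices `T` (hopping) and `D` (double occupancy). This file is its algebraic engine
(`squarefree_charpoly_pencil_of_transcendental`): if the characteristic polynomial over `ℤ[X]` of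
the pencil `T + X·D` is squarefree, then at every real coupling `U` transcendental over `ℚ` the
characteristic polynomial of `T + U·D` is squarefree, i.e. every eigenvalue is simple.

Proof. The specialisation `φ : ℤ[X] → ℝ`, `X ↦ U`, is injective (transcendence over `ℚ`
is transcendence over `ℤ`, `transcendental_iff_injective`); the real pencil is the entrywise
image of the `ℤ[X]`-pencil, so its characteristic polynomial is the image of the (monic) one
over `ℤ[X]` (`Matrix.charpoly_map`); a monic squarefree polynomial over the integrally closed
domain `ℤ[X]` stays squarefree over the fraction field `ℚ(X)` (Gauss's lemma,
`IsIntegrallyClosed.eq_map_mul_C_of_dvd`, `squarefree_map_fractionRing_of_monic`); squarefree is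
separable in characteristic zero (`PerfectField.separable_iff_squarefree`); and separability is
preserved along the field embedding `ℚ(X) → ℝ` extending `φ` (`IsFractionRing.lift`,
`Polynomial.Separable.map`, `Polynomial.Separable.squarefree`).

Context: the discriminant of the pencil is an integer polynomial in `U`, so level crossings of
`T + U·D` sit at algebraic couplings unless the discriminant vanishes identically — the
von Neumann–Wigner non-crossing rule (J. von Neumann, E. Wigner, Phys. Z. 30 (1929) 467) and its
refinement for linear pencils, H. K. Owusu, K. Wagh, E. A. Yuzbashyan, J. Phys. A 42 (2009)
035206. Pure Mathlib algebra; no new definitions.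
-/

-- the mandated namespace `Summit.<Summit>.<Problem>.Theorems` repeats `HubbardSuperconductivity`
-- (single-problem summit, D-0017), which the `dupNamespace` linter flags on every declaration
set_option linter.dupNamespace false

namespace Summit.HubbardSuperconductivity.HubbardSuperconductivity.Theorems.JosephsonMirror

open Polynomial

/-- Gauss's lemma, squarefree form: a MONIC squarefree polynomial over an integrally closed
domain stays squarefree over the fraction field (a square factor `x²` over the field is, up to
the unit `C x.leadingCoeff`, the image of a monic square factor over the domain,
`IsIntegrallyClosed.eq_map_mul_C_of_dvd` and `Monic.dvd_iff_fraction_map_dvd_fraction_map`).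
[folklore] -/
theorem squarefree_map_fractionRing_of_monic {A K : Type*} [CommRing A] [IsDomain A]
    [IsIntegrallyClosed A] [Field K] [Algebra A K] [IsFractionRing A K] {p : A[X]}
    (hp : p.Monic) (hsq : Squarefree p) : Squarefree (p.map (algebraMap A K)) := by
  intro x hx
  have hx0 : x ≠ 0 := by
    rintro rfl
    exact (hp.map (algebraMap A K)).ne_zero (zero_dvd_iff.mp ((dvd_mul_right 0 0).trans hx))
  have hx₁ : (x * C x.leadingCoeff⁻¹).Monic := monic_mul_leadingCoeff_inv hx0
  have hxx₁ : x * C x.leadingCoeff⁻¹ ∣ x :=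
    ⟨C x.leadingCoeff, by
      rw [mul_assoc, ← C_mul, inv_mul_cancel₀ (leadingCoeff_ne_zero.mpr hx0), C_1, mul_one]⟩
  have hdvd : x * C x.leadingCoeff⁻¹ * (x * C x.leadingCoeff⁻¹) ∣ p.map (algebraMap A K) :=
    (mul_dvd_mul hxx₁ hxx₁).trans hx
  obtain ⟨g, hg⟩ :=
    IsIntegrallyClosed.eq_map_mul_C_of_dvd K hp ((dvd_mul_right _ _).trans hdvd)
  rw [hx₁.leadingCoeff, C_1, mul_one] at hg
  have hgm : g.Monic := monic_of_injective (IsFractionRing.injective A K) (hg ▸ hx₁)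
  have hgg : g * g ∣ p :=
    (hp.dvd_iff_fraction_map_dvd_fraction_map (K := K) (hgm.mul hgm)).mp
      (by rwa [Polynomial.map_mul, hg])
  have hg1 : g = 1 := hgm.isUnit_iff.mp (hsq g hgg)
  have h1 : x * C x.leadingCoeff⁻¹ = 1 := by rw [← hg, hg1, Polynomial.map_one]
  exact IsUnit.of_mul_eq_one _ h1

/-- Specialisation along an INJECTIVE ring map into a field preserves squarefreeness of monic
polynomials over an integrally closed domain of characteristic zero: squarefree over the domain
⇒ squarefree over the fraction field (Gauss) ⇒ separable there (characteristic zero is perfect)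
⇒ separable, hence squarefree, after the field embedding extending the map. [folklore] -/
theorem squarefree_map_of_monic_of_injective {A L : Type*} [CommRing A] [IsDomain A]
    [IsIntegrallyClosed A] [CharZero A] [Field L] {φ : A →+* L} (hφ : Function.Injective φ)
    {p : A[X]} (hp : p.Monic) (hsq : Squarefree p) : Squarefree (p.map φ) := by
  have hK : (p.map (algebraMap A (FractionRing A))).Separable :=
    PerfectField.separable_iff_squarefree.mpr (squarefree_map_fractionRing_of_monic hp hsq)
  have hφ' : (IsFractionRing.lift hφ : FractionRing A →+* L).comp
      (algebraMap A (FractionRing A)) = φ :=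
    RingHom.ext (IsFractionRing.lift_algebraMap hφ)
  rw [← hφ', ← Polynomial.map_map]
  exact hK.map.squarefree

/-- **Squarefree integer pencils stay squarefree at transcendental couplings.** For integer
matrices `T, D` and a real `U` transcendental over `ℚ`: if the characteristic polynomial over
`ℤ[X]` of the linear pencil `T + X·D` is squarefree, then the characteristic polynomial of the
real matrix `T + U·D` is squarefree (all its eigenvalues are simple). The real pencil is the
entrywise image of the `ℤ[X]`-pencil under the injective specialisation `X ↦ U`
(`transcendental_iff_injective`, `Matrix.charpoly_map`), and
`squarefree_map_of_monic_of_injective` applies to the monic characteristic polynomial. Context: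
von Neumann–Wigner non-crossing rule; Owusu–Wagh–Yuzbashyan, J. Phys. A 42 (2009) 035206
(level crossings of linear matrix pencils). [folklore] -/
theorem squarefree_charpoly_pencil_of_transcendental {n : Type*} [Fintype n] [DecidableEq n]
    (T D : Matrix n n ℤ) (U : ℝ) (hU : Transcendental ℚ U)
    (hsq : Squarefree (T.map (algebraMap ℤ (Polynomial ℤ)) +
      (Polynomial.X : Polynomial ℤ) • D.map (algebraMap ℤ (Polynomial ℤ))).charpoly) :
    Squarefree (T.map (Int.castRingHom ℝ) + U • D.map (Int.castRingHom ℝ)).charpoly := by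
  -- the specialisation `X ↦ U`, injective by transcendence of `U` over `ℤ`
  have hφ : Function.Injective (Polynomial.aeval U : ℤ[X] →ₐ[ℤ] ℝ).toRingHom :=
    transcendental_iff_injective.mp (hU.restrictScalars (algebraMap ℤ ℚ).injective_int)
  have hM : T.map (Int.castRingHom ℝ) + U • D.map (Int.castRingHom ℝ) =
      (T.map (algebraMap ℤ (Polynomial ℤ)) +
        (Polynomial.X : Polynomial ℤ) • D.map (algebraMap ℤ (Polynomial ℤ))).map
        (Polynomial.aeval U : ℤ[X] →ₐ[ℤ] ℝ).toRingHom := by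
    ext i j
    simp
  rw [hM, Matrix.charpoly_map]
  exact squarefree_map_of_monic_of_injective hφ (Matrix.charpoly_monic _) hsq

/-- Registered stub `stub_transcendental_squarefree` of crux stmt-HubbardSuperconductivity-2228
(`JmCusp`, line `Sketch`), verbatim signature: a squarefree characteristic polynomial of the
integer pencil `T + X·D` over `ℤ[X]` stays squarefree when `X` is specialised to a real coupling
`U` transcendental over `ℚ`. Alias of `squarefree_charpoly_pencil_of_transcendental`.
[folklore] -/
theorem stub_transcendental_squarefree {n : Type} [Fintype n] [DecidableEq n]
    (T D : Matrix n n ℤ) (U : ℝ) (hU : Transcendental ℚ U)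
    (hsq : Squarefree (T.map (algebraMap ℤ (Polynomial ℤ)) +
      (Polynomial.X : Polynomial ℤ) • D.map (algebraMap ℤ (Polynomial ℤ))).charpoly) :
    Squarefree (T.map (Int.castRingHom ℝ) + U • D.map (Int.castRingHom ℝ)).charpoly :=
  squarefree_charpoly_pencil_of_transcendental T D U hU hsq

end Summit.HubbardSuperconductivity.HubbardSuperconductivity.Theorems.JosephsonMirror
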